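/-
Copyright (c) 2026 the pub-hodgecm-mathlib formalisation cell (harness21).  Prover seat hodgecm-mathlib-K2Liu-p12 (g3): Track B «K2-LIT»,
#184♮ = hLiu418 = stmt-HodgeConjecture-24832; Road Φ of socket #41, Φ9 consumer sheet row G1 = organ Φ3d, file (d2) (K2E5-plan (g7) deal (b′) 2026-09-04T11:53:45Z,
«=» 12:01:15Z; census `K2/K2Liu-p12/g3/CENSUS-G1-WhittakerDeltaEulerHead.K2Liu-p12-g3.md`).
-/
import Summits.HodgeConjecture.HodgeConjecture.Theorems.K2LiuWhittakerDeltaEulerHead            -- ★ (d3) the hypothesis-first Euler head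
import Summits.HodgeConjecture.HodgeConjecture.Theorems.K2LiuStdFamilyFactorisablePrelims      -- ★ #31s kit: `archPart_mul'`, `evalPlace_finPart_mul'` on `H(𝔸)`
import HarnessLib

/-!
# Crux `HLiu418`, Road Φ of socket #41, organ Φ3d, file (d2) — THE SECTION SIDE OF THE EULER HEAD: the shape (F) of `u ↦ f_s(w_Δ u h)` for a family
# factorizable off `T`, and the row-G1 head for such families

Cell `hodgecm-mathlib`, crux item hLiu418 = `stmt-HodgeConjecture-24832`, route of record `HCCMUnconditional`; squad K2 ∕ K2Liu, road `K2_Liu`,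
socket #41 `sig_K2LiuSiegelEisensteinContinuation`, Road Φ; Φ9 consumer sheet row G1.  THEOREMS ONLY (no `def`, no `instance`, no `notation`, no
named-fact hypothesis, no `sorry`); lane `--supports stmt-HodgeConjecture-24832` (count-neutral helper; closes no socket by itself).

THE MATHEMATICS.  ★ #31s `stdFamilyFactorisable` delivers, for a standard family `f` right-invariant under `K^T_H`, the factorisation
★ `IsFactorizableOff T χ f fT`: `f_s(x) = fT_s(x_∞, x_T) · ∏ᶠ_{v∉T} Λ_{s,v}(x_v)` with the `K_{H,v}`-spherical local sections `Λ_{s,v} =` ★ `LambdaLoc`.  At the point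
`x = w_Δ u h` of the twisted big-cell integrand (`u ∈ N_Δ(𝔸)`, `h_v ∈ K_{H,v}` and `w_{Δ,v} ∈ K_{H,v}` off `T`) the components are `x_∞ = w_Δ u_∞ h_∞`,
`x_v = w_Δ u_v h_v` (★ `archPart_mul'`, ★ `evalPlace_finPart_mul'`; `u_∞ = (unipDeltaSplit u).1`, `u_v = (unipDeltaSplit u).2 v` by `rfl`), and
`Λ_{s,v}(w_Δ u_v h_v) = Λ_{s,v}(w_Δ u_v)` (★ `lambdaLoc_mul_localInt`), `Λ_{s,v}(w_Δ k) = 1` for `k ∈ K_{H,v} ∩ N_Δ(L⁺_v)` (★ `lambdaLoc_of_mem_localInt`):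
* §1 **`apply_weylDelta_mul_eq_mul_finprod`** — the section-side letter `hfT` of ★ (d3) `K2LiuWhittakerDeltaEulerHead.whittakerDelta_eq_mul_tprod` with
  `FT(a, x) := fT_s(w_Δ a h_∞, (w_Δ x_v h_v)_{v∈T})`, `Λ_v(y) := Λ_{s,v}(w_Δ y)`; **`lambdaLoc_weylDelta_mul_eq_one_of_mem`** — its letter `hΛK`;
* §2 **`whittakerDelta_eq_mul_tprod_of_isFactorizableOff`** — ROW G1's HEAD FOR FACTORIZABLE FAMILIES: for `f` with `IsFactorizableOff T χ f fT`, `χ` unramified off `T`,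
  `h_v, w_{Δ,v} ∈ K_{H,v}` off `T`, the character side by value (`hψ`, `hψK` — file (d1)) and `G ∈ L¹(νN)` (★ O41.3):
  `W_S(f_s)(h) = (∫ ΨT(p)·fT_s(w_Δ p_∞ h_∞, (w_Δ p_v h_v)_T) d(ν_∞ ⊗ ⊗_{v∈T} ν_v)) · ∏'_{v∉T} ∫_{N_Δ(L⁺_v)} Ψ_v(y) Λ_{s,v}(w_Δ y) dν_v(y)`
  — the local factor off `T` is the SPHERICAL local Whittaker coefficient `W°_{S,v}(s)` (`h_v ∈ K_{H,v}` has dropped out), as row G1's face says.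
TYPING.  All component identities are composed STRUCTURALLY (`Eq.trans`, `congrArg`, `Prod.ext`, `funext`) — no `rw`∕`simp` across goals carrying `unipDeltaSplit u`
components (those time out on the `DFunLike` towers, see ★ (d3)); default heartbeats.
HONEST LABEL.  Count-neutral helper; it retires nothing by itself: `HC_CM` is proved only modulo the 7 printed citations (2 remaining named inputs:
hLiu418 = `stmt-HodgeConjecture-24832`, h413 = `stmt-HodgeConjecture-24833`) until rung 0 closes.

## References
* [KudlaRallis1994] S. Kudla, S. Rallis, Ann. of Math. 140 (1994): §1–§2.   * [Tan1999] V. Tan, Canad. J. Math. 51 (1999): §2–§3.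
* [Liu2011] Y. Liu, Algebra Number Theory 5 (2011): §2B p. 862, §2C (2-4) p. 863 (standard sections, the spherical `Λ_{s,v}`).
* [BorelJacquet1979] A. Borel, H. Jacquet, PSPM 33.1 (1979): §4.1.   * [Li1992] J.-S. Li, J. reine angew. Math. 428 (1992): §3.
-/

set_option autoImplicit false
-- the mandated namespace repeats the single-problem summit's segment (`HodgeConjecture.HodgeConjecture`)
set_option linter.dupNamespace false

noncomputable section

open scoped Matrix RestrictedProduct ENNReal NNReal Topology ComplexConjugate
open NumberField IsDedekindDomain MeasureTheory Measure Filter Set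

namespace Summit.HodgeConjecture.HodgeConjecture.Cruxes.HLiu418.K2LiuWhittakerDeltaIntegrandFactorisation

open Literature.NumberTheory.Automorphic Literature.NumberTheory.GaloisRepresentations
open Literature.NumberTheory.GelbartRogawski1991 Literature.NumberTheory.GelbartRogawski1991.GRConstruction
open Literature.NumberTheory.K2Lit.SiegelDoubled
open Literature.NumberTheory.K2Lit.PlaceSplitting
open Literature.MeasureTheory.RestrictedProduct
open Literature.Topology.Algebra.RestrictedProduct (inH)
open Summit.HodgeConjecture.HodgeConjecture.Cruxes.HLiu418.K2LiuSiegelUnipotentLocalDefs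
open Summit.HodgeConjecture.HodgeConjecture.Cruxes.HLiu418.K2LiuSiegelUnipotentSplitDefs
open Summit.HodgeConjecture.HodgeConjecture.Cruxes.HLiu418.K2LiuSiegelUnipotentSplitAtDefs
open Summit.HodgeConjecture.HodgeConjecture.Cruxes.HLiu418.K2LiuSiegelUnipotentHaarPinned
open Summit.HodgeConjecture.HodgeConjecture.Cruxes.HLiu418.K2LiuSiegelUnipotentEulerProduct
open Summit.HodgeConjecture.HodgeConjecture.Cruxes.HLiu418.K2LiuSiegelUnipotentFourierDefs
open Summit.HodgeConjecture.HodgeConjecture.Cruxes.HLiu418.K2LiuWhittakerDeltaEulerHead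
open Summit.HodgeConjecture.HodgeConjecture.Cruxes.HLiu418.K2LiuStdFamilyFactorisable (archPart_mul' evalPlace_finPart_mul')

variable (L : Type) [Field L] [NumberField L] [IsCMField L]
variable {N M n : ℕ} (e : Fin N × Fin M ≃ Fin n)
  (dV : Fin N → L) (hdV : ∀ i, IsCMField.complexConj L (dV i) = dV i)
  (dW : Fin M → L) (hdW : ∀ i, IsCMField.complexConj L (dW i) = dW i)
  (T : Finset (HeightOneSpectrum (𝓞 (Fp L)))) [DecidableEq (HeightOneSpectrum (𝓞 (Fp L)))]

/-! ## §1 The shape (F) of `u ↦ f_s(w_Δ u h)` and the local letter `Λ_{s,v}(w_Δ k) = 1` -/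

section Shape

omit [DecidableEq (HeightOneSpectrum (𝓞 (Fp L)))] in
set_option maxHeartbeats 800000 in -- MEASURED (> 400 000, ≤ 800 000): elaboration of `archPart`∕`evalPlace ∘ finPart` at `w_Δ u h` on the doubled unitary datum's binder telescope; plain `exact`, no search tactics
/-- **THE SECTION SIDE `hfT`**: for `f` factorizable off `T` (★ `IsFactorizableOff T χ f fT`), `χ` unramified off `T`, `h_v ∈ K_{H,v}` off `T`, and `u ∈ N_Δ(𝔸)`:
`f_s(w_Δ u h) = fT_s(w_Δ u_∞ h_∞, (w_Δ u_v h_v)_{v∈T}) · ∏ᶠ_{v∉T} Λ_{s,v}(w_Δ u_v)` in the coordinates `u_∞ = (unipDeltaSplit u).1`, `u_v = (unipDeltaSplit u).2 v`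
(components of the triple product ★ `archPart_mul'` ∕ ★ `evalPlace_finPart_mul'`; `Λ_{s,v}(w_Δ u_v h_v) = Λ_{s,v}(w_Δ u_v)` ★ `lambdaLoc_mul_localInt`).
[cite: Liu2011, §2B p. 862] [cite: KudlaRallis1994, §1] [cite: BorelJacquet1979, §4.1] -/
theorem apply_weylDelta_mul_eq_mul_finprod
    {χ : HeckeCharacter L} (hχ : ∀ v, v ∉ T → ∀ w' : UnitaryGroup.PlacesOver L v, χ.IsUnramifiedAt w'.1)
    {f : ℂ → HA L e dV hdV dW hdW → ℂ}
    {fT : ℂ → UnitaryGroup.arch (Fp L) L (IsCMField.complexConj L) (n + n) (hermD L e dV hdV dW hdW) ×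
      (Π v : T, UnitaryGroup.localPi L (IsCMField.complexConj L) (n + n) (hermD L e dV hdV dW hdW) v.1) → ℂ}
    (hfac : IsFactorizableOff L e dV hdV dW hdW T χ f fT) (s : ℂ) {h : HA L e dV hdV dW hdW}
    (hh : ∀ v, v ∉ T → UnitaryGroup.evalPlace (Fp L) L (IsCMField.complexConj L) (n + n) (hermD L e dV hdV dW hdW) v
      (UnitaryGroup.finPart (Fp L) L (IsCMField.complexConj L) (n + n) (hermD L e dV hdV dW hdW) h) ∈
        UnitaryGroup.localInt L (IsCMField.complexConj L) (n + n) (hermD L e dV hdV dW hdW) v)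
    (u : ↥(unipDelta L e dV hdV dW hdW)) :
    f s (weylDelta L e dV hdV dW hdW * (u : HA L e dV hdV dW hdW) * h) =
      fT s (UnitaryGroup.archPart (Fp L) L (IsCMField.complexConj L) (n + n) (hermD L e dV hdV dW hdW) (weylDelta L e dV hdV dW hdW) *
            ((unipDeltaSplit L e dV hdV dW hdW u).1 : UnitaryGroup.arch (Fp L) L (IsCMField.complexConj L) (n + n) (hermD L e dV hdV dW hdW)) *
            UnitaryGroup.archPart (Fp L) L (IsCMField.complexConj L) (n + n) (hermD L e dV hdV dW hdW) h,
          fun v : T => UnitaryGroup.evalPlace (Fp L) L (IsCMField.complexConj L) (n + n) (hermD L e dV hdV dW hdW) v.1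
              (UnitaryGroup.finPart (Fp L) L (IsCMField.complexConj L) (n + n) (hermD L e dV hdV dW hdW) (weylDelta L e dV hdV dW hdW)) *
            (((unipDeltaSplit L e dV hdV dW hdW u).2 v.1 : ↥(unipDeltaLoc L e dV hdV dW hdW v.1)) :
              UnitaryGroup.localPi L (IsCMField.complexConj L) (n + n) (hermD L e dV hdV dW hdW) v.1) *
            UnitaryGroup.evalPlace (Fp L) L (IsCMField.complexConj L) (n + n) (hermD L e dV hdV dW hdW) v.1
              (UnitaryGroup.finPart (Fp L) L (IsCMField.complexConj L) (n + n) (hermD L e dV hdV dW hdW) h)) *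
        ∏ᶠ v : {v : HeightOneSpectrum (𝓞 (Fp L)) // v ∉ T},
          LambdaLoc L e dV hdV dW hdW v.1 χ s
            (UnitaryGroup.evalPlace (Fp L) L (IsCMField.complexConj L) (n + n) (hermD L e dV hdV dW hdW) v.1
                (UnitaryGroup.finPart (Fp L) L (IsCMField.complexConj L) (n + n) (hermD L e dV hdV dW hdW) (weylDelta L e dV hdV dW hdW)) *
              (((unipDeltaSplit L e dV hdV dW hdW u).2 v.1 : ↥(unipDeltaLoc L e dV hdV dW hdW v.1)) :
                UnitaryGroup.localPi L (IsCMField.complexConj L) (n + n) (hermD L e dV hdV dW hdW) v.1)) := by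
  -- the archimedean component of `w_Δ u h`
  have hA : UnitaryGroup.archPart (Fp L) L (IsCMField.complexConj L) (n + n) (hermD L e dV hdV dW hdW)
        (weylDelta L e dV hdV dW hdW * (u : HA L e dV hdV dW hdW) * h) =
      UnitaryGroup.archPart (Fp L) L (IsCMField.complexConj L) (n + n) (hermD L e dV hdV dW hdW) (weylDelta L e dV hdV dW hdW) *
        ((unipDeltaSplit L e dV hdV dW hdW u).1 : UnitaryGroup.arch (Fp L) L (IsCMField.complexConj L) (n + n) (hermD L e dV hdV dW hdW)) *
        UnitaryGroup.archPart (Fp L) L (IsCMField.complexConj L) (n + n) (hermD L e dV hdV dW hdW) h :=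
    (archPart_mul' L e dV hdV dW hdW _ h).trans (congrArg (· * _) ((archPart_mul' L e dV hdV dW hdW _ _).trans
      (congrArg (_ * ·) (coe_unipDeltaSplit_fst L e dV hdV dW hdW u).symm)))
  -- the finite components of `w_Δ u h`
  have hE : ∀ v : HeightOneSpectrum (𝓞 (Fp L)),
      UnitaryGroup.evalPlace (Fp L) L (IsCMField.complexConj L) (n + n) (hermD L e dV hdV dW hdW) v
          (UnitaryGroup.finPart (Fp L) L (IsCMField.complexConj L) (n + n) (hermD L e dV hdV dW hdW) (weylDelta L e dV hdV dW hdW * (u : HA L e dV hdV dW hdW) * h)) =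
        UnitaryGroup.evalPlace (Fp L) L (IsCMField.complexConj L) (n + n) (hermD L e dV hdV dW hdW) v
            (UnitaryGroup.finPart (Fp L) L (IsCMField.complexConj L) (n + n) (hermD L e dV hdV dW hdW) (weylDelta L e dV hdV dW hdW)) *
          (((unipDeltaSplit L e dV hdV dW hdW u).2 v : ↥(unipDeltaLoc L e dV hdV dW hdW v)) :
            UnitaryGroup.localPi L (IsCMField.complexConj L) (n + n) (hermD L e dV hdV dW hdW) v) *
          UnitaryGroup.evalPlace (Fp L) L (IsCMField.complexConj L) (n + n) (hermD L e dV hdV dW hdW) v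
            (UnitaryGroup.finPart (Fp L) L (IsCMField.complexConj L) (n + n) (hermD L e dV hdV dW hdW) h) :=
    fun v => (evalPlace_finPart_mul' L e dV hdV dW hdW v _ h).trans (congrArg (· * _) ((evalPlace_finPart_mul' L e dV hdV dW hdW v _ _).trans
      (congrArg (_ * ·) (coe_unipDeltaSplit_snd_apply L e dV hdV dW hdW u v).symm)))
  -- the spherical factors: `Λ_{s,v}(w_Δ u_v h_v) = Λ_{s,v}(w_Δ u_v)` off `T`
  have hC : ∀ v : {v : HeightOneSpectrum (𝓞 (Fp L)) // v ∉ T},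
      LambdaLoc L e dV hdV dW hdW v.1 χ s
          (UnitaryGroup.evalPlace (Fp L) L (IsCMField.complexConj L) (n + n) (hermD L e dV hdV dW hdW) v.1
            (UnitaryGroup.finPart (Fp L) L (IsCMField.complexConj L) (n + n) (hermD L e dV hdV dW hdW) (weylDelta L e dV hdV dW hdW * (u : HA L e dV hdV dW hdW) * h))) =
        LambdaLoc L e dV hdV dW hdW v.1 χ s
          (UnitaryGroup.evalPlace (Fp L) L (IsCMField.complexConj L) (n + n) (hermD L e dV hdV dW hdW) v.1
              (UnitaryGroup.finPart (Fp L) L (IsCMField.complexConj L) (n + n) (hermD L e dV hdV dW hdW) (weylDelta L e dV hdV dW hdW)) *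
            (((unipDeltaSplit L e dV hdV dW hdW u).2 v.1 : ↥(unipDeltaLoc L e dV hdV dW hdW v.1)) :
              UnitaryGroup.localPi L (IsCMField.complexConj L) (n + n) (hermD L e dV hdV dW hdW) v.1)) :=
    fun v => (congrArg (LambdaLoc L e dV hdV dW hdW v.1 χ s) (hE v.1)).trans
      (lambdaLoc_mul_localInt L e dV hdV dW hdW v.1 χ s (hχ v.1 v.2) _ (hh v.1 v.2))
  refine (hfac s (weylDelta L e dV hdV dW hdW * (u : HA L e dV hdV dW hdW) * h)).trans ?_
  exact congrArg₂ (fun p g => fT s p * g) (Prod.ext hA (funext fun v : T => hE v.1)) (finprod_congr hC)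

omit [DecidableEq (HeightOneSpectrum (𝓞 (Fp L)))] in
/-- **THE LOCAL LETTER `hΛK`: `Λ_{s,v}(w_Δ k) = 1` for `k ∈ K_{H,v} ∩ N_Δ(L⁺_v)`, `v ∉ T`** (`w_{Δ,v} ∈ K_{H,v}` — p03's Φ3-R2 letter, by value — and ★ `lambdaLoc_of_mem_localInt`).
[cite: Liu2011, §2C (2-4) p. 863] [cite: Li1992, §3] -/
theorem lambdaLoc_weylDelta_mul_eq_one_of_mem
    {χ : HeckeCharacter L} (hχ : ∀ v, v ∉ T → ∀ w' : UnitaryGroup.PlacesOver L v, χ.IsUnramifiedAt w'.1) (s : ℂ)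
    (hw : ∀ v, v ∉ T → UnitaryGroup.evalPlace (Fp L) L (IsCMField.complexConj L) (n + n) (hermD L e dV hdV dW hdW) v
      (UnitaryGroup.finPart (Fp L) L (IsCMField.complexConj L) (n + n) (hermD L e dV hdV dW hdW) (weylDelta L e dV hdV dW hdW)) ∈
        UnitaryGroup.localInt L (IsCMField.complexConj L) (n + n) (hermD L e dV hdV dW hdW) v)
    (v : HeightOneSpectrum (𝓞 (Fp L))) (hv : v ∉ T) (k : ↥(unipDeltaLoc L e dV hdV dW hdW v))
    (hk : k ∈ inH (fun v => UnitaryGroup.localInt L (IsCMField.complexConj L) (n + n) (hermD L e dV hdV dW hdW) v) (fun v => unipDeltaLoc L e dV hdV dW hdW v) v) :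
    LambdaLoc L e dV hdV dW hdW v χ s
      (UnitaryGroup.evalPlace (Fp L) L (IsCMField.complexConj L) (n + n) (hermD L e dV hdV dW hdW) v
          (UnitaryGroup.finPart (Fp L) L (IsCMField.complexConj L) (n + n) (hermD L e dV hdV dW hdW) (weylDelta L e dV hdV dW hdW)) *
        (k : UnitaryGroup.localPi L (IsCMField.complexConj L) (n + n) (hermD L e dV hdV dW hdW) v)) = 1 :=
  lambdaLoc_of_mem_localInt L e dV hdV dW hdW v χ s (hχ v hv) (mul_mem (hw v hv) (Subgroup.mem_subgroupOf.1 hk))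

end Shape

/-! ## §2 Row G1's head for a factorizable family -/

variable [MeasurableSpace ↥(unipDelta L e dV hdV dW hdW)] [BorelSpace ↥(unipDelta L e dV hdV dW hdW)]
  [MeasurableSpace ↥(unipDeltaArch L e dV hdV dW hdW)] [BorelSpace ↥(unipDeltaArch L e dV hdV dW hdW)]
  [∀ v : HeightOneSpectrum (𝓞 (Fp L)), MeasurableSpace ↥(unipDeltaLoc L e dV hdV dW hdW v)] [∀ v : HeightOneSpectrum (𝓞 (Fp L)), BorelSpace ↥(unipDeltaLoc L e dV hdV dW hdW v)]

set_option maxHeartbeats 800000 in -- MEASURED (> 400 000, ≤ 800 000): the adelic doubled unitary datum + the Haar∕Borel tower of `N_∞ × (Π_{v∈T} N_v × Πʳ_{v∉T} N_v)`; plain `exact`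
/-- **ROW G1's HEAD FOR A FAMILY FACTORIZABLE OFF `T`** (★ (d3) `whittakerDelta_eq_mul_tprod` with §1's letters): Φ3c's measure letters verbatim, `χ` unramified off `T`,
`IsFactorizableOff T χ f fT` (★ #31s), `h_v, w_{Δ,v} ∈ K_{H,v}` off `T`, the character side by value (`hψ`, `hψK`; file (d1)), `G ∈ L¹(νN)` (★ O41.3):
`W_S(f_s)(h) = (∫ ΨT(p)·fT_s(w_Δ p_∞ h_∞, (w_Δ p_v h_v)_{v∈T}) d(ν_∞ ⊗ ⊗_{v∈T} ν_v)) · ∏'_{v∉T} ∫_{N_Δ(L⁺_v)} Ψ_v(y)·Λ_{s,v}(w_Δ y) dν_v(y)` (+ integrability of the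
transported integrand) — the local factor off `T` is the spherical local Whittaker coefficient `W°_{S,v}(s)`; `h` enters only through `T`.
[cite: KudlaRallis1994, §1–§2] [cite: Tan1999, §2–§3] [cite: Liu2011, §2B p. 862] -/
theorem whittakerDelta_eq_mul_tprod_of_isFactorizableOff
    (νN : Measure ↥(unipDelta L e dV hdV dW hdW)) (νv : ∀ v : HeightOneSpectrum (𝓞 (Fp L)), Measure ↥(unipDeltaLoc L e dV hdV dW hdW v)) [∀ v, (νv v).IsHaarMeasure]
    [∀ v, SigmaFinite (νv v)]
    (hνK : ∀ v, v ∉ T → νv v (((inH (fun v => UnitaryGroup.localInt L (IsCMField.complexConj L) (n + n) (hermD L e dV hdV dW hdW) v) (fun v => unipDeltaLoc L e dV hdV dW hdW v) v) : Subgroup ↥(unipDeltaLoc L e dV hdV dW hdW v)) : Set ↥(unipDeltaLoc L e dV hdV dW hdW v)) = 1)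
    (νinf : Measure ↥(unipDeltaArch L e dV hdV dW hdW)) [SigmaFinite νinf]
    (hmap : Measure.map (unipDeltaSplitAt L e dV hdV dW hdW T) νN =
      νinf.prod ((Measure.pi fun v : T => νv v.1).prod
        (rpMeasure (fun v : {v : HeightOneSpectrum (𝓞 (Fp L)) // v ∉ T} => ((inH (fun v => UnitaryGroup.localInt L (IsCMField.complexConj L) (n + n) (hermD L e dV hdV dW hdW) v) (fun v => unipDeltaLoc L e dV hdV dW hdW v) v.1 : Subgroup ↥(unipDeltaLoc L e dV hdV dW hdW v.1)) : Set ↥(unipDeltaLoc L e dV hdV dW hdW v.1))) (fun v => νv v.1) ∅)))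
    {χ : HeckeCharacter L} (hχ : ∀ v, v ∉ T → ∀ w' : UnitaryGroup.PlacesOver L v, χ.IsUnramifiedAt w'.1)
    {f : ℂ → HA L e dV hdV dW hdW → ℂ}
    {fT : ℂ → UnitaryGroup.arch (Fp L) L (IsCMField.complexConj L) (n + n) (hermD L e dV hdV dW hdW) ×
      (Π v : T, UnitaryGroup.localPi L (IsCMField.complexConj L) (n + n) (hermD L e dV hdV dW hdW) v.1) → ℂ}
    (hfac : IsFactorizableOff L e dV hdV dW hdW T χ f fT) (s : ℂ) (S : Matrix (Fin n) (Fin n) L) {h : HA L e dV hdV dW hdW}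
    (hh : ∀ v, v ∉ T → UnitaryGroup.evalPlace (Fp L) L (IsCMField.complexConj L) (n + n) (hermD L e dV hdV dW hdW) v
      (UnitaryGroup.finPart (Fp L) L (IsCMField.complexConj L) (n + n) (hermD L e dV hdV dW hdW) h) ∈
        UnitaryGroup.localInt L (IsCMField.complexConj L) (n + n) (hermD L e dV hdV dW hdW) v)
    (hw : ∀ v, v ∉ T → UnitaryGroup.evalPlace (Fp L) L (IsCMField.complexConj L) (n + n) (hermD L e dV hdV dW hdW) v
      (UnitaryGroup.finPart (Fp L) L (IsCMField.complexConj L) (n + n) (hermD L e dV hdV dW hdW) (weylDelta L e dV hdV dW hdW)) ∈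
        UnitaryGroup.localInt L (IsCMField.complexConj L) (n + n) (hermD L e dV hdV dW hdW) v)
    {ΨT : ↥(unipDeltaArch L e dV hdV dW hdW) × (Π v : T, ↥(unipDeltaLoc L e dV hdV dW hdW v.1)) → ℂ}
    {Ψv : ∀ v : HeightOneSpectrum (𝓞 (Fp L)), ↥(unipDeltaLoc L e dV hdV dW hdW v) → ℂ}
    (hψ : ∀ u : ↥(unipDelta L e dV hdV dW hdW), conj (unipDeltaChar L e dV hdV dW hdW S (u : HA L e dV hdV dW hdW) : ℂ) =
      ΨT ((unipDeltaSplit L e dV hdV dW hdW u).1, fun v : T => (unipDeltaSplit L e dV hdV dW hdW u).2 v.1) *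
        ∏ᶠ v : {v : HeightOneSpectrum (𝓞 (Fp L)) // v ∉ T}, Ψv v.1 ((unipDeltaSplit L e dV hdV dW hdW u).2 v.1))
    (hψK : ∀ v, v ∉ T → ∀ k : ↥(unipDeltaLoc L e dV hdV dW hdW v),
      k ∈ inH (fun v => UnitaryGroup.localInt L (IsCMField.complexConj L) (n + n) (hermD L e dV hdV dW hdW) v) (fun v => unipDeltaLoc L e dV hdV dW hdW v) v →
        Ψv v k = 1)
    (hG : Integrable (fun u : ↥(unipDelta L e dV hdV dW hdW) =>
      conj (unipDeltaChar L e dV hdV dW hdW S (u : HA L e dV hdV dW hdW) : ℂ) * f s (weylDelta L e dV hdV dW hdW * (u : HA L e dV hdV dW hdW) * h)) νN) :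
    Integrable (fun z : (↥(unipDeltaArch L e dV hdV dW hdW) × (Π v : T, ↥(unipDeltaLoc L e dV hdV dW hdW v.1))) × (Πʳ v : {v : HeightOneSpectrum (𝓞 (Fp L)) // v ∉ T}, [↥(unipDeltaLoc L e dV hdV dW hdW v.1), inH (fun v => UnitaryGroup.localInt L (IsCMField.complexConj L) (n + n) (hermD L e dV hdV dW hdW) v) (fun v => unipDeltaLoc L e dV hdV dW hdW v) v.1]) =>
        (ΨT z.1 *
            fT s (UnitaryGroup.archPart (Fp L) L (IsCMField.complexConj L) (n + n) (hermD L e dV hdV dW hdW) (weylDelta L e dV hdV dW hdW) *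
                  (z.1.1 : UnitaryGroup.arch (Fp L) L (IsCMField.complexConj L) (n + n) (hermD L e dV hdV dW hdW)) *
                  UnitaryGroup.archPart (Fp L) L (IsCMField.complexConj L) (n + n) (hermD L e dV hdV dW hdW) h,
                fun v : T => UnitaryGroup.evalPlace (Fp L) L (IsCMField.complexConj L) (n + n) (hermD L e dV hdV dW hdW) v.1
                    (UnitaryGroup.finPart (Fp L) L (IsCMField.complexConj L) (n + n) (hermD L e dV hdV dW hdW) (weylDelta L e dV hdV dW hdW)) *
                  ((z.1.2 v : ↥(unipDeltaLoc L e dV hdV dW hdW v.1)) : UnitaryGroup.localPi L (IsCMField.complexConj L) (n + n) (hermD L e dV hdV dW hdW) v.1) *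
                  UnitaryGroup.evalPlace (Fp L) L (IsCMField.complexConj L) (n + n) (hermD L e dV hdV dW hdW) v.1
                    (UnitaryGroup.finPart (Fp L) L (IsCMField.complexConj L) (n + n) (hermD L e dV hdV dW hdW) h))) *
          ∏ᶠ v : {v : HeightOneSpectrum (𝓞 (Fp L)) // v ∉ T},
            Ψv v.1 (z.2 v) *
              LambdaLoc L e dV hdV dW hdW v.1 χ s
                (UnitaryGroup.evalPlace (Fp L) L (IsCMField.complexConj L) (n + n) (hermD L e dV hdV dW hdW) v.1
                    (UnitaryGroup.finPart (Fp L) L (IsCMField.complexConj L) (n + n) (hermD L e dV hdV dW hdW) (weylDelta L e dV hdV dW hdW)) *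
                  ((z.2 v : ↥(unipDeltaLoc L e dV hdV dW hdW v.1)) : UnitaryGroup.localPi L (IsCMField.complexConj L) (n + n) (hermD L e dV hdV dW hdW) v.1)))
      ((νinf.prod (Measure.pi fun v : T => νv v.1)).prod (rpMeasure (fun v : {v : HeightOneSpectrum (𝓞 (Fp L)) // v ∉ T} => ((inH (fun v => UnitaryGroup.localInt L (IsCMField.complexConj L) (n + n) (hermD L e dV hdV dW hdW) v) (fun v => unipDeltaLoc L e dV hdV dW hdW v) v.1 : Subgroup ↥(unipDeltaLoc L e dV hdV dW hdW v.1)) : Set ↥(unipDeltaLoc L e dV hdV dW hdW v.1))) (fun v => νv v.1) ∅)) ∧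
    whittakerDelta L e dV hdV dW hdW νN S (f s) h =
      (∫ p, ΨT p *
          fT s (UnitaryGroup.archPart (Fp L) L (IsCMField.complexConj L) (n + n) (hermD L e dV hdV dW hdW) (weylDelta L e dV hdV dW hdW) *
                (p.1 : UnitaryGroup.arch (Fp L) L (IsCMField.complexConj L) (n + n) (hermD L e dV hdV dW hdW)) *
                UnitaryGroup.archPart (Fp L) L (IsCMField.complexConj L) (n + n) (hermD L e dV hdV dW hdW) h,
              fun v : T => UnitaryGroup.evalPlace (Fp L) L (IsCMField.complexConj L) (n + n) (hermD L e dV hdV dW hdW) v.1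
                  (UnitaryGroup.finPart (Fp L) L (IsCMField.complexConj L) (n + n) (hermD L e dV hdV dW hdW) (weylDelta L e dV hdV dW hdW)) *
                ((p.2 v : ↥(unipDeltaLoc L e dV hdV dW hdW v.1)) : UnitaryGroup.localPi L (IsCMField.complexConj L) (n + n) (hermD L e dV hdV dW hdW) v.1) *
                UnitaryGroup.evalPlace (Fp L) L (IsCMField.complexConj L) (n + n) (hermD L e dV hdV dW hdW) v.1
                  (UnitaryGroup.finPart (Fp L) L (IsCMField.complexConj L) (n + n) (hermD L e dV hdV dW hdW) h))
          ∂(νinf.prod (Measure.pi fun v : T => νv v.1))) *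
        ∏' v : {v : HeightOneSpectrum (𝓞 (Fp L)) // v ∉ T},
          ∫ y, Ψv v.1 y *
            LambdaLoc L e dV hdV dW hdW v.1 χ s
              (UnitaryGroup.evalPlace (Fp L) L (IsCMField.complexConj L) (n + n) (hermD L e dV hdV dW hdW) v.1
                  (UnitaryGroup.finPart (Fp L) L (IsCMField.complexConj L) (n + n) (hermD L e dV hdV dW hdW) (weylDelta L e dV hdV dW hdW)) *
                (y : UnitaryGroup.localPi L (IsCMField.complexConj L) (n + n) (hermD L e dV hdV dW hdW) v.1)) ∂(νv v.1) :=
  whittakerDelta_eq_mul_tprod L e dV hdV dW hdW T νN νv hνK νinf hmap s S h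
    (FT := fun p => fT s (UnitaryGroup.archPart (Fp L) L (IsCMField.complexConj L) (n + n) (hermD L e dV hdV dW hdW) (weylDelta L e dV hdV dW hdW) *
        (p.1 : UnitaryGroup.arch (Fp L) L (IsCMField.complexConj L) (n + n) (hermD L e dV hdV dW hdW)) *
        UnitaryGroup.archPart (Fp L) L (IsCMField.complexConj L) (n + n) (hermD L e dV hdV dW hdW) h,
      fun v : T => UnitaryGroup.evalPlace (Fp L) L (IsCMField.complexConj L) (n + n) (hermD L e dV hdV dW hdW) v.1
          (UnitaryGroup.finPart (Fp L) L (IsCMField.complexConj L) (n + n) (hermD L e dV hdV dW hdW) (weylDelta L e dV hdV dW hdW)) *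
        ((p.2 v : ↥(unipDeltaLoc L e dV hdV dW hdW v.1)) : UnitaryGroup.localPi L (IsCMField.complexConj L) (n + n) (hermD L e dV hdV dW hdW) v.1) *
        UnitaryGroup.evalPlace (Fp L) L (IsCMField.complexConj L) (n + n) (hermD L e dV hdV dW hdW) v.1
          (UnitaryGroup.finPart (Fp L) L (IsCMField.complexConj L) (n + n) (hermD L e dV hdV dW hdW) h)))
    (Λv := fun v y => LambdaLoc L e dV hdV dW hdW v χ s
      (UnitaryGroup.evalPlace (Fp L) L (IsCMField.complexConj L) (n + n) (hermD L e dV hdV dW hdW) v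
          (UnitaryGroup.finPart (Fp L) L (IsCMField.complexConj L) (n + n) (hermD L e dV hdV dW hdW) (weylDelta L e dV hdV dW hdW)) *
        (y : UnitaryGroup.localPi L (IsCMField.complexConj L) (n + n) (hermD L e dV hdV dW hdW) v)))
    hψ hψK (fun u => apply_weylDelta_mul_eq_mul_finprod L e dV hdV dW hdW T hχ hfac s hh u)
    (fun v hv k hk => lambdaLoc_weylDelta_mul_eq_one_of_mem L e dV hdV dW hdW T hχ s hw v hv k hk) hG

end Summit.HodgeConjecture.HodgeConjecture.Cruxes.HLiu418.K2LiuWhittakerDeltaIntegrandFactorisation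

end
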